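import Literature.Analysis.FluidPDE.AdaptedBackwardKernel

/-!
# Crux `AdaptedKernelExists` (stmt-NavierStokesRegularity-2956), line `nash-entropy-last-block`:
  the concentration clause is FORCED by unit mass + the Gaussian upper bound (refuter, stub `stub_kernelLimit`)

Negative-lane helper file (`--supports stmt-NavierStokesRegularity-2956`; asserts no Theses decl).
Attack-surface reduction for the compactness stub `stub_kernelLimit` of the picked line: of the five
clauses its limit kernel `G` must satisfy, clause (5) (`∫ φ G(t) → φ(x₀)` as `t ↑ T` for bounded
continuous `φ`) can never fail once clause (2) (`G ≥ 0`), clause (4) (unit mass) and the Gaussian UPPER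
bound `G ≤ C₁ (T−t)^{-3/2} e^{−‖x−x₀‖²/(C₂(T−t))}` hold near `T` — by an ELEMENTARY Gaussian-tail bound,
with no dominated convergence and no information about the approximating kernels:
`|∫ φ G(t) − φ(x₀)| ≤ ε/3 + 2M C₁ (2πC₂)^{3/2} e^{−η²/(2C₂(T−t))}` (`|φ − φ(x₀)| < ε/3` on `B(x₀, η)`,
`|φ| ≤ M`; off the ball bound `e^{−r²/(C₂h)} ≤ e^{−η²/(2C₂h)} e^{−r²/(2C₂h)}` and recognise
`(T−t)^{-3/2} e^{−r²/(2C₂(T−t))}` as `(2πC₂)^{3/2}` times the backward heat kernel of diffusivity `C₂/2`,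
which has unit mass).  So a refutation of `stub_kernelLimit` could only come from the `C²` /
equation / mass clauses of the limit, not from concentration; and the lead may import
`tendsto_integral_mul_of_gaussianUpper_Ico` for clause (5) verbatim (its hypotheses are clauses (2), (4)
on `Ico t₀ T` and the stub's upper bound).
-/

noncomputable section

open MeasureTheory Set Function Filter Topology Metric
open Literature.Analysis.FluidPDE

namespace Summit.NavierStokesRegularity.NavierStokesRegularity.Theorems.AdaptedKernelExistsNegative.Concentration

/-- **Concentration from unit mass and a Gaussian upper bound.** If, for `t` in a set `S` that
`𝓝[<] T` eventually enters, `G(t, ·) ≥ 0` has unit mass and lies below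
`C₁ (T−t)^{-3/2} e^{−‖x−x₀‖²/(C₂(T−t))}` (`C₂ > 0`), then `∫ φ G(t) → φ(x₀)` as `t ↑ T` for every bounded
continuous `φ`. -/
theorem tendsto_integral_mul_of_gaussianUpper {S : Set ℝ} {T C₁ C₂ : ℝ} {x₀ : EuclideanSpace ℝ (Fin 3)}
    {G : ℝ → EuclideanSpace ℝ (Fin 3) → ℝ} (hS : ∀ᶠ t in 𝓝[<] T, t ∈ S) (hC₂ : 0 < C₂)
    (hone : ∀ t ∈ S, ∫ x, G t x = 1) (hpos : ∀ t ∈ S, ∀ x, 0 ≤ G t x)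
    (hup : ∀ t ∈ S, ∀ x,
      G t x ≤ C₁ * (T - t) ^ (-(3:ℝ) / 2) * Real.exp (-(‖x - x₀‖ ^ 2) / (C₂ * (T - t))))
    {φ : EuclideanSpace ℝ (Fin 3) → ℝ} (hφ : Continuous φ) (hM : ∃ M : ℝ, ∀ x, |φ x| ≤ M) :
    Tendsto (fun t => ∫ x, φ x * G t x) (𝓝[<] T) (𝓝 (φ x₀)) := by
  obtain ⟨M, hM⟩ := hM
  have hM0 : 0 ≤ M := (abs_nonneg _).trans (hM x₀)
  have hν : (0:ℝ) < C₂ / 2 := by positivity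
  obtain ⟨κ, hκ⟩ : ∃ κ : ℝ, κ = (4 * Real.pi * (C₂ / 2)) ^ (-(3:ℝ) / 2) := ⟨_, rfl⟩
  have hκpos : 0 < κ := by rw [hκ]; exact Real.rpow_pos_of_pos (by positivity) _
  rw [Metric.tendsto_nhds]
  intro ε hε
  obtain ⟨η, hη, hφη⟩ := Metric.continuousAt_iff.1 hφ.continuousAt (ε / 3) (by positivity)
  -- the tail factor `e₀(t) = exp(−η²/(2C₂(T−t)))` tends to zero as `t ↑ T`
  obtain ⟨e₀, he₀⟩ : ∃ e₀ : ℝ → ℝ, e₀ = fun t => Real.exp (-(η ^ 2) / (2 * C₂ * (T - t))) :=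
    ⟨_, rfl⟩
  have he : Tendsto e₀ (𝓝[<] T) (𝓝 0) := by
    have h1 : Tendsto (fun t : ℝ => T - t) (𝓝[<] T) (𝓝[>] 0) := by
      refine tendsto_nhdsWithin_iff.2 ⟨?_, ?_⟩
      · have hc : Continuous (fun t : ℝ => T - t) := by fun_prop
        have := hc.tendsto T
        simp only [sub_self] at this
        exact this.mono_left nhdsWithin_le_nhds
      · filter_upwards [self_mem_nhdsWithin] with t ht
        exact sub_pos.2 (mem_Iio.1 ht)
    have h2 : Tendsto (fun t : ℝ => (T - t)⁻¹) (𝓝[<] T) atTop := tendsto_inv_nhdsGT_zero.comp h1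
    have h3 : Tendsto (fun t : ℝ => -(η ^ 2 / (2 * C₂) * (T - t)⁻¹)) (𝓝[<] T) atBot :=
      tendsto_neg_atTop_atBot.comp (h2.const_mul_atTop (by positivity))
    have h4 := Real.tendsto_exp_atBot.comp h3
    refine h4.congr (fun t => ?_)
    simp only [he₀, Function.comp_apply]
    congr 1
    generalize T - t = s
    ring
  have hL : Tendsto (fun t => 2 * M * C₁ * κ⁻¹ * e₀ t) (𝓝[<] T) (𝓝 0) := by
    simpa using he.const_mul (2 * M * C₁ * κ⁻¹)
  have hLε : ∀ᶠ t in 𝓝[<] T, 2 * M * C₁ * κ⁻¹ * e₀ t < ε / 3 :=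
    hL.eventually_lt_const (by positivity)
  filter_upwards [hS, hLε, self_mem_nhdsWithin] with t htS htL htT
  have ht : t < T := htT
  have hh : 0 < T - t := sub_pos.2 ht
  have hp : 0 < (T - t) ^ (-(3:ℝ) / 2) := Real.rpow_pos_of_pos hh _
  -- the sign of `C₁` (the hypotheses force it at any `t ∈ S`)
  have hC₁ : 0 ≤ C₁ := by
    have h1 := hup t htS x₀
    have h0 := hpos t htS x₀
    simp only [sub_self, norm_zero, ne_eq, OfNat.ofNat_ne_zero, not_false_eq_true, zero_pow,
      neg_zero, zero_div, Real.exp_zero, mul_one] at h1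
    exact le_of_mul_le_mul_right (by linarith) hp
  -- the comparison Gaussian is the backward heat kernel of diffusivity `C₂/2`
  have hK := isAdaptedBackwardKernel_backwardHeatKernel (E := EuclideanSpace ℝ (Fin 3)) hν T x₀
  have hGi : Integrable (G t) := by
    by_contra hG
    have := hone t htS
    rw [integral_undef hG] at this
    exact zero_ne_one this
  have hBi : Integrable (backwardHeatKernel (C₂ / 2) T x₀ t) := hK.integrable ht
  have hB1 : ∫ x, backwardHeatKernel (C₂ / 2) T x₀ t x = 1 := integral_backwardHeatKernel hν x₀ ht
  have hBeq : ∀ x, backwardHeatKernel (C₂ / 2) T x₀ t x =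
      κ * (T - t) ^ (-(3:ℝ) / 2) * Real.exp (-(‖x - x₀‖ ^ 2) / (4 * (C₂ / 2) * (T - t))) := by
    intro x
    have h := backwardHeatKernel_eq (E := EuclideanSpace ℝ (Fin 3)) hν.le x₀ ht x
    rw [finrank_euclideanSpace_fin] at h
    rw [h, hκ]
    norm_num
  have he₀t : 0 ≤ e₀ t := by rw [he₀]; exact (Real.exp_pos _).le
  obtain ⟨L, hLdef⟩ : ∃ L : ℝ, L = 2 * M * C₁ * κ⁻¹ * e₀ t := ⟨_, rfl⟩
  have hL0 : 0 ≤ L := by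
    rw [hLdef]
    have := hκpos.le
    positivity
  -- pointwise bound of the integrand by an integrable Gaussian-dominated function
  have hpt : ∀ x, ‖(φ x - φ x₀) * G t x‖ ≤
      ε / 3 * G t x + L * backwardHeatKernel (C₂ / 2) T x₀ t x := by
    intro x
    have hG0 := hpos t htS x
    have hB0 : 0 ≤ backwardHeatKernel (C₂ / 2) T x₀ t x := (hK.pos t ht x).le
    rw [norm_mul, Real.norm_eq_abs, Real.norm_eq_abs, abs_of_nonneg hG0]
    by_cases hx : dist x x₀ < η
    · have h1 : |φ x - φ x₀| ≤ ε / 3 := by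
        have := hφη hx
        rw [Real.dist_eq] at this
        exact this.le
      calc |φ x - φ x₀| * G t x ≤ ε / 3 * G t x := mul_le_mul_of_nonneg_right h1 hG0
        _ ≤ ε / 3 * G t x + L * backwardHeatKernel (C₂ / 2) T x₀ t x :=
            le_add_of_nonneg_right (mul_nonneg hL0 hB0)
    · rw [not_lt, dist_eq_norm] at hx
      have h1 : |φ x - φ x₀| ≤ 2 * M := by
        calc |φ x - φ x₀| ≤ |φ x| + |φ x₀| := abs_sub _ _
          _ ≤ M + M := add_le_add (hM x) (hM x₀)
          _ = 2 * M := by ring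
      have h2 := hup t htS x
      have hexp : Real.exp (-(‖x - x₀‖ ^ 2) / (C₂ * (T - t))) ≤
          e₀ t * Real.exp (-(‖x - x₀‖ ^ 2) / (4 * (C₂ / 2) * (T - t))) := by
        rw [he₀, ← Real.exp_add]
        apply Real.exp_le_exp.2
        rw [← sub_nonneg]
        have hkey : -(η ^ 2) / (2 * C₂ * (T - t)) + -(‖x - x₀‖ ^ 2) / (4 * (C₂ / 2) * (T - t)) -
            -(‖x - x₀‖ ^ 2) / (C₂ * (T - t)) = (‖x - x₀‖ ^ 2 - η ^ 2) / (2 * C₂ * (T - t)) := by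
          field_simp
          ring
        rw [hkey]
        exact div_nonneg (by nlinarith [hx, hη.le, norm_nonneg (x - x₀)]) (by positivity)
      have hκne : κ ≠ 0 := hκpos.ne'
      calc |φ x - φ x₀| * G t x
          ≤ (2 * M) * (C₁ * (T - t) ^ (-(3:ℝ) / 2) *
              Real.exp (-(‖x - x₀‖ ^ 2) / (C₂ * (T - t)))) := mul_le_mul h1 h2 hG0 (by positivity)
        _ ≤ (2 * M) * (C₁ * (T - t) ^ (-(3:ℝ) / 2) *
              (e₀ t * Real.exp (-(‖x - x₀‖ ^ 2) / (4 * (C₂ / 2) * (T - t))))) := by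
            gcongr
        _ = L * backwardHeatKernel (C₂ / 2) T x₀ t x := by
            rw [hBeq x, hLdef]
            field_simp
        _ ≤ ε / 3 * G t x + L * backwardHeatKernel (C₂ / 2) T x₀ t x :=
            le_add_of_nonneg_left (mul_nonneg (by positivity) hG0)
  -- integrate
  have hint : ‖∫ x, (φ x - φ x₀) * G t x‖ ≤ ε / 3 + L := by
    have hgi : Integrable (fun x => ε / 3 * G t x + L * backwardHeatKernel (C₂ / 2) T x₀ t x) :=
      (hGi.const_mul _).add (hBi.const_mul _)
    calc ‖∫ x, (φ x - φ x₀) * G t x‖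
        ≤ ∫ x, (ε / 3 * G t x + L * backwardHeatKernel (C₂ / 2) T x₀ t x) :=
          norm_integral_le_of_norm_le hgi (Eventually.of_forall hpt)
      _ = ε / 3 + L := by
          rw [integral_add (hGi.const_mul _) (hBi.const_mul _), integral_const_mul,
            integral_const_mul, hone t htS, hB1]
          ring
  -- identify `∫ φ G(t) − φ(x₀)` with `∫ (φ − φ(x₀)) G(t)` (unit mass)
  have hφG : Integrable (fun x => φ x * G t x) :=
    hGi.bdd_mul hφ.aestronglyMeasurable (Eventually.of_forall fun x => by
      rw [Real.norm_eq_abs]; exact hM x)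
  have hdiff : (∫ x, φ x * G t x) - φ x₀ = ∫ x, (φ x - φ x₀) * G t x := by
    have h2 : Integrable (fun x => φ x₀ * G t x) := hGi.const_mul _
    simp_rw [sub_mul]
    rw [integral_sub hφG h2, integral_const_mul, hone t htS, mul_one]
  rw [Real.dist_eq, hdiff]
  calc |∫ x, (φ x - φ x₀) * G t x| = ‖∫ x, (φ x - φ x₀) * G t x‖ := (Real.norm_eq_abs _).symm
    _ ≤ ε / 3 + L := hint
    _ < ε := by rw [hLdef]; linarith [htL]

/-- **Clause (5) of `stub_kernelLimit`'s limit kernel, for free.** On a window `Ico t₀ T`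
(`t₀ < T`): positivity, unit mass and the stub's Gaussian upper bound (constants `C₁`, `C₂ > 0`)
imply concentration at `x₀` in the exact form of `IsAdaptedBackwardKernel.tendsto_integral_mul`. -/
theorem tendsto_integral_mul_of_gaussianUpper_Ico {t₀ T C₁ C₂ : ℝ} {x₀ : EuclideanSpace ℝ (Fin 3)}
    {G : ℝ → EuclideanSpace ℝ (Fin 3) → ℝ}
    (ht₀ : t₀ < T) (hC₂ : 0 < C₂)
    (hone : ∀ t ∈ Ico t₀ T, ∫ x, G t x = 1) (hpos : ∀ t ∈ Ico t₀ T, ∀ x, 0 ≤ G t x)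
    (hup : ∀ t ∈ Ico t₀ T, ∀ x,
      G t x ≤ C₁ * (T - t) ^ (-(3:ℝ) / 2) * Real.exp (-(‖x - x₀‖ ^ 2) / (C₂ * (T - t)))) :
    ∀ φ : EuclideanSpace ℝ (Fin 3) → ℝ, Continuous φ → (∃ M : ℝ, ∀ x, |φ x| ≤ M) →
      Tendsto (fun t => ∫ x, φ x * G t x) (𝓝[<] T) (𝓝 (φ x₀)) :=
  fun _ hφ hM => tendsto_integral_mul_of_gaussianUpper (Ico_mem_nhdsLT ht₀) hC₂ hone hpos hup hφ hM

end Summit.NavierStokesRegularity.NavierStokesRegularity.Theorems.AdaptedKernelExistsNegative.Concentration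

end
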